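import Summits.BirchSwinnertonDyer.BirchSwinnertonDyer.Theorems.UniversalToricDescentRoadFFMemberCongruenceOdd
import Summits.BirchSwinnertonDyer.BirchSwinnertonDyer.Theorems.ErratumRoadFiveIMCDivRoadFFFittingFrameBOfMembers
import HarnessLib

/-!
# Route `UniversalToricDescent`, crux `TwinSplitIMCAtThreeMult` (item stmt-BirchSwinnertonDyer-20694, bucket B),
# line `threeframes`, stub `stub_wanFrameMult` via the member tower: the Road-FF DESCENT KERNEL at any odd
# `p ≥ 3` from an ABSTRACT Hida member tower, and its specialisation to the 3-multiplicative twin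

Cell `bsd-wall` (run/shared/lean/pub/bsd-wall/), seat `bsd-wall-utd-p2` (lead prover g11, 2026-08-28);
`--supports stmt-BirchSwinnertonDyer-20694 --as helper`; Theses-free (the twin binders are spelled out).

## What this file proves and why it exists

The tree's Road-FF deciding kernel `P2.RoadFF.fittingCongruenceFrameAtErratumDataB_of_weak_facts` (cell bsd-stepL,
crux 20169) turns «frame of `f` + Hida members `g_m ≡ f (mod p^m)` with the one-sided member inclusions (2.5)_m and
the congruence (c)» into the two-slot Fitting-level congruence frame
`P2.RoadFF.FittingCongruenceFrameTwoSlotAt W p κ 𝔭 𝔭bar γ ι f Σ(K) P_Σ(K,κ)` — but ONLY at an ERRATUM DATUM (`p ≥ 5`,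
a ramified non-split `q`, [Cas20] standing hypotheses), because its member input is the erratum-shaped OPEN package.
The crux idea `member-tower-fitting-limit` (utd-idea g18) needs the same descent at `p = 3` for the MULTIPLICATIVE TWIN
`W′` of a wild curve under the route's ALL-SPLIT Heegner field, with the member tower as an abstract input (its engine
— a weight-`k_m` Yan–Zhu/[SU14] inclusion under all-split `K` — is the line's research stub, not this file's concern).

* §1 **`P2.RoadFF.fittingCongruenceFrameTwoSlotAt_of_memberTower_odd`** — THE DESCENT KERNEL, binder-generic:
  `3 ≤ p`, `E[p]` irreducible, `p ∥ N`, `K` imaginary quadratic with `p` split, the X-slot `𝔭bar ∣ p`, (dec)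
  `E(ℚ_p)[p] = 0`, a frame `(Ω_K, Ω_p, L)` of `f` at the frame prime `𝔭`, and for every `m ≥ 1` a Hida member
  `D_m : HidaCongruentMember W p m` with the receptacle clause «`X^Σ_ac(A_{g_m})` torsion → `Ch·S₀⟦T⟧ ⊆ (L_m)`» ∧
  «`(L_m) ⊆ (L·P_Σ) + (p^m)`» ⟹ the two-slot frame. Proof = the weak-facts kernel with the erratum-datum unpacking
  removed and the member congruence `e_m` taken at `3 ≤ p` from `nonempty_memberCongruence_odd_of_facts`
  (file `UniversalToricDescentRoadFFMemberCongruenceOdd`); the PUBLISHED inputs (SelBC) and [SU14] Lemma 3.1.9 are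
  the tree's discharged theorems `…_holds`; the only named-fact binder left is Shapiro `hSh` ([SU14] Prop. 3.2.3).
* §2 **`twin_fittingCongruenceFrameTwoSlotAt_of_memberTower`** — the specialisation to the binders of crux
  20694 / ♭B at `p = 3` (`Mult W′ 3`, `ρ̄₃` onto ⇒ irreducible, `SatisfiesHeegnerHypothesis N′ K` with `3 ∣ N′` ⇒
  `3` split, `𝔭' ∋ 3` the X-slot), under the extra local binder (dec) `W′(ℚ₃)[3] = 0` — automatic for NON-split
  multiplicative reduction at `3`, a genuine condition (Tate parameter not a cube in `ℚ₃`) for split reduction.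
* §3 **`twin_exists_wanFrame_of_sigmaData_of_memberTower`** — with the twin's `Σ`-data
  (`P2.RoadFF.SigmaDataAt W′ 3 κ 𝔭' γ Σ P_Σ`: torsion of `X^Σ_ac(W′)`, `P_Σ ≠ 0`, the (3.1)-inclusion) the tree's
  recombination `P2.exists_unrFrame_charIdeal_map_le_of_roadFF_fitting_twoSlot` yields EXACTLY the consequent of the
  registered stub `stub_wanFrameMult` (= ♭B `TwinWanFrameAtThreeMult`) at that datum, with `k = 0`.

HONEST FRAMING: theorems only (no definition, no named fact, no instance, no `sorry`); CONDITIONAL on the displayed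
hypotheses (the member tower is RESEARCH — «beyond print»: K1 of the idea card; Shapiro is PUBLISHED); nothing is
booked; the anticyclotomic main conjecture is asserted nowhere; BSD is proved for no curve; no census number moves.

References: [Castella2018Erratum] Thm. 1.1, (b), (c), Lemma 2.1, (2.5), proof of Thm. 1.1 (pp. 1–4);
[Skinner2016PacificMC] §2.6 (2-6-1) (`p ≥ 3`), §3.1 (a)(b)(c) (p. 192); [SkinnerUrban2014] Prop. 3.2.3, Lemma 3.1.9;
[Castella2020JIMJ] §2.5, Thm. 2.11 ((c), `p > 2`); [Castella2018] Thm. 3.1, (3.1) (arXiv:1704.06608 p. 9);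
crux idea `Cruxes/TwinSplitIMCAtThreeMult/Ideas/member-tower-fitting-limit.md` (utd-idea g18, e87824c1880f5314).
-/

set_option autoImplicit false

noncomputable section

open scoped TensorProduct Classical

open CategoryTheory PowerSeries NumberField IsDedekindDomain Field WeierstrassCurve
open Literature.NumberTheory.GaloisRepresentations Literature.NumberTheory.EllipticCurves
  Literature.NumberTheory.EllipticCurves.BigGaloisRep Literature.NumberTheory.EllipticCurves.GreenbergSelmer
  Literature.NumberTheory.EllipticCurves.Skinner2016 Literature.NumberTheory.EllipticCurves.Rank1Residual
  Literature.NumberTheory.EllipticCurves.Rank1Residual.Typed Literature.NumberTheory.EllipticCurves.ModularForms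
  Literature.NumberTheory.EllipticCurves.Castella2018
open Summit.BirchSwinnertonDyer.Rank1Residual.X11b.Halves Summit.BirchSwinnertonDyer.Rank1Residual.X11b.AcSelmer

namespace Summit.BirchSwinnertonDyer.Rank1Residual.X11b

open RoadFFMember Summit.BirchSwinnertonDyer.BirchSwinnertonDyer.Theorems

/-! ### §1 The descent kernel at any odd `p ≥ 3` from an abstract member tower -/

-- The closing `exact` unifies five `ℕ`-indexed families of coefficient rings / modules / maps with the feeder's
-- binders; like the weak-facts kernel it needs ≈ 2× the default heartbeat budget.
set_option maxHeartbeats 400000 in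
/-- **ROAD FF DESCENT KERNEL AT ANY ODD PRIME FROM AN ABSTRACT MEMBER TOWER.** For a globally minimal `E/ℚ`, `p ≥ 3`
with `E[p]` irreducible and `p ∥ N` (`Mult`), `K` imaginary quadratic with `p` split, the X-slot `𝔭bar ∋ p`, (dec)
`E(ℚ_p)[p] = 0`, a frame `(Ω_K ≠ 0, Ω_p ∈ R₀ˣ, L)` of a cusp form `f` at the frame prime `𝔭` [Cas18 Thm. 3.1 shape],
and, for every `m ≥ 1`, a Hida member `g_m` of `f_E` congruent mod `p^m` [Ski16 §2.6] whose `Σ`-imprimitive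
Selmer dual satisfies, in every receptacle `S₀`, the one-sided (2.5)_m UNDER the torsion premise and the congruence
(c) `(L_m) ⊆ (L·P_Σ) + (p^m)` [Cas20 2.11 shape]: the two-slot Fitting-level congruence frame
`P2.RoadFF.FittingCongruenceFrameTwoSlotAt W p κ 𝔭 𝔭bar γ ι f Σ(K) P_Σ(K,κ)` (`Σ = W.sigmaPlacesFinset p K`,
`P_Σ = W.sigmaEulerElement p K κ`). Assembly as in `…_of_weak_facts`: per `m` the member `D_m` (level `max m 1`), its
coefficient ring `𝒪_m` (PID, finite free over `ℤ_p`: (T1)), the receptacle `(R₀ ⊗_{ℤ_p} 𝒪_m)⟦T⟧` (faithfully flat: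
(T4)), finite generation of `X^Σ_ac(A_{g_m})` ([SU14] 3.1.9 `…_holds` + (T6)(T7)(T8a)), the congruence `e_m`
(`nonempty_memberCongruence_odd_of_facts`: Shapiro `hSh` + (SelBC) `…_holds` + (Frob) + (b) + Lemma 2.1), (c) re-spelt
(`span_le_sup_of_receptacle`), fed to `P2.RoadFF.fittingCongruenceFrameTwoSlotAt_of_members_descent_le_printed`.
CONDITIONAL on the named fact `hSh` (PUBLISHED) and on the member tower `hmem` (RESEARCH at `p ∥ N` under an
all-split `K`); nothing is booked; BSD is proved for no curve.
[cite: Castella2018Erratum, (b), (c), Lemma 2.1, (2.5) and proof of Thm. 1.1 (pp. 2–4)]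
[cite: Skinner2016PacificMC, §2.3 (p. 179), §2.6 (2-6-1), §3.1 (a)(b)(c) (p. 192)] [cite: SkinnerUrban2014, Prop. 3.2.3, Lemma 3.1.9]
[cite: Castella2020JIMJ, §2.5, Thm. 2.11] [cite: Castella2018, Thm. 3.1, (3.1) (arXiv:1704.06608 p. 9)] -/
theorem P2.RoadFF.fittingCongruenceFrameTwoSlotAt_of_memberTower_odd
    (hSh : SkinnerUrban2014.prop323_XAc_equiv_XBigDecomp)
    (W : WeierstrassCurve ℚ) [W.IsElliptic] [W.IsGloballyMinimal] (p : ℕ) [Fact p.Prime] (hp : 3 ≤ p)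
    (K : Type) [Field K] [NumberField K] (hK : IsImaginaryQuadratic K) (hirr : Irr W p) (hmult : Mult W p)
    (hsp : SplitsIn K p) (hiv : ∀ Q : (W.baseChange ℚ_[p]).toAffine.Point, p • Q = 0 → Q = 0)
    (κ : ZpExtension K p) (hκ : κ.IsAnticyclotomic) (γ : Field.absoluteGaloisGroup K) [Fact (κ.IsTopGenerator γ)]
    (𝔭 𝔭bar : HeightOneSpectrum (𝓞 K)) (h𝔭bar : ((p : ℕ) : 𝓞 K) ∈ 𝔭bar.asIdeal)
    (ι : PadicAlgCl p ≃+* ℂ) {N : ℕ} (f : CuspForm (CongruenceSubgroup.Gamma0 N) 2)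
    {ΩK : ℂ} {Ωp : (unrIntegers p)ˣ} {L : UnrSeries p} (hΩ : ΩK ≠ 0)
    (hL : IsBDPLFunction ι 𝔭 κ γ f ΩK ((Ωp : unrIntegers p) : ℂ_[p]) L)
    (hmem : ∀ m : ℕ, 1 ≤ m →
      ∃ D : Skinner2016.HidaCongruentMember W p m,
        ∀ [TopologicalSpace (PowerSeries (padicCoeffIntegers D.ι))]
          [ContinuousSMul (PowerSeries (padicCoeffIntegers D.ι))
            (BigRepModule (padicCoeffIntegers D.ι) p (Cofree D.Δ.ρ (padicCoeffField D.ι)))],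
        ∀ (S₀ : Type) [CommRing S₀] (a : unrIntegers p →+* S₀) (b : padicCoeffIntegers D.ι →+* S₀)
          (j : ℤ_[p] →+* unrIntegers p),
          (∀ x : ℤ_[p], ((j x : unrIntegers p) : ℂ_[p]) = algebraMap ℚ_[p] ℂ_[p] (x : ℚ_[p])) →
          a.comp j = b.comp (algebraMap ℤ_[p] (padicCoeffIntegers D.ι)) →
          ∃ Lm : PowerSeries S₀,
            (Module.IsTorsion (PowerSeries (padicCoeffIntegers D.ι))
                (XBig κ (D.Δ.cofreeRepOver K) 𝔭bar (↑(W.sigmaPlacesFinset p K))) →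
              (XBig.charIdeal κ (D.Δ.cofreeRepOver K) 𝔭bar (↑(W.sigmaPlacesFinset p K))).map
                  (PowerSeries.map b) ≤ Ideal.span {Lm}) ∧
            Ideal.span {Lm} ≤
              Ideal.span {PowerSeries.map a (L * PowerSeries.map j (W.sigmaEulerElement p K κ))} ⊔
                Ideal.span {((p : ℕ) : PowerSeries S₀) ^ m}) :
    P2.RoadFF.FittingCongruenceFrameTwoSlotAt W p κ 𝔭 𝔭bar γ ι f
      (↑(W.sigmaPlacesFinset p K) : Set (HeightOneSpectrum (𝓞 K))) (W.sigmaEulerElement p K κ) := by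
  -- ### elementary consequences of the binders
  have hpN : p ∣ W.conductorNorm ℤ := dvd_conductorNorm_of_mult hmult
  have hN0 : W.conductorNorm ℤ ≠ 0 := (W.conductorNorm_pos_holds).ne'
  -- `p ∥ N` (conductor exponent one at a multiplicative prime), so `p ∤ N/p`
  have hpM : ¬ p ∣ W.conductorNorm ℤ / p := by
    have hfac := W.factorization_conductorNorm_eq_one_of_hasMultiplicativeReductionAtPrime p hmult
    intro h
    have h2 : p ^ 2 ∣ W.conductorNorm ℤ := by
      rw [pow_two]
      exact Nat.mul_dvd_of_dvd_div hpN h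
    have := ((Fact.out : p.Prime).pow_dvd_iff_le_factorization hN0).mp h2
    omega
  have hMpos : 0 < W.conductorNorm ℤ / p :=
    Nat.div_pos (Nat.le_of_dvd (Nat.pos_of_ne_zero hN0) hpN) (Fact.out : p.Prime).pos
  haveI : NeZero (W.conductorNorm ℤ / p) := ⟨hMpos.ne'⟩
  have hHp : SatisfiesHeegnerHypothesis p K := satisfiesHeegnerHypothesis_of_splitsIn Fact.out hsp
  -- ### `Σ`
  have hSfin : (↑(W.sigmaPlacesFinset p K) : Set (HeightOneSpectrum (𝓞 K))).Finite :=
    (W.sigmaPlacesFinset p K).finite_toSet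
  have hSp : ∀ w ∈ (↑(W.sigmaPlacesFinset p K) : Set (HeightOneSpectrum (𝓞 K))),
      ((p : ℕ) : 𝓞 K) ∉ w.asIdeal :=
    fun w hw => W.forall_mem_sigmaPlacesFinset_not_mem p K w (Finset.mem_coe.1 hw)
  have hS : ∀ w : HeightOneSpectrum (𝓞 K), w ∉ (↑(W.sigmaPlacesFinset p K) : Set (HeightOneSpectrum (𝓞 K))) →
      ((p : ℕ) : 𝓞 K) ∉ w.asIdeal → (W.baseChange K).HasGoodReductionAt w := by
    intro w hw hwp
    rw [WeierstrassCurve.coe_sigmaPlacesFinset] at hw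
    exact WeierstrassCurve.hasGoodReductionAt_baseChange_of_not_mem_sigmaPlaces hw hwp
  have hSM : ∀ w : HeightOneSpectrum (𝓞 K), w ∉ (↑(W.sigmaPlacesFinset p K) : Set (HeightOneSpectrum (𝓞 K))) →
      ((W.conductorNorm ℤ / p : ℕ) : 𝓞 K) ∉ w.asIdeal := by
    intro w hw hM'
    rw [WeierstrassCurve.coe_sigmaPlacesFinset] at hw
    exact hw (WeierstrassCurve.mem_sigmaPlaces_of_tameLevel_mem hpN hpM hM')
  -- ### `K_{𝔭bar} → ℚ_p` (degree one: `p` splits in the quadratic field `K`)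
  obtain ⟨heb, hfb⟩ := degreeOne_of_splitsIn hK.1 hsp h𝔭bar
  obtain ⟨φ⟩ := AcSelmer.exists_ringHom_adicCompletion_padic_of_degreeOne p 𝔭bar h𝔭bar heb hfb
  -- ### a member at every level `max m 1`
  choose Dm hDm using fun m : ℕ => hmem (max m 1) (le_max_right m 1)
  -- ### topologies (the statements are topology-free; take discrete ones) and coefficient-ring instances
  letI : TopologicalSpace (IwasawaAlgebra p) := ⊥
  haveI : DiscreteTopology (IwasawaAlgebra p) := ⟨rfl⟩
  letI τ : ∀ m : ℕ, TopologicalSpace (PowerSeries (padicCoeffIntegers (Dm m).ι)) := fun _ => ⊥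
  haveI : ∀ m : ℕ, DiscreteTopology (PowerSeries (padicCoeffIntegers (Dm m).ι)) := fun _ => ⟨rfl⟩
  haveI : ∀ m : ℕ, IsPrincipalIdealRing (padicCoeffIntegers (Dm m).ι) := fun m =>
    (Dm m).isPrincipalIdealRing_coeffRing
  haveI : ∀ m : ℕ, Module.Free ℤ_[p] (padicCoeffIntegers (Dm m).ι) := fun m => (Dm m).moduleFree_coeffRing
  haveI : ∀ m : ℕ, Module.Finite ℤ_[p] (padicCoeffIntegers (Dm m).ι) := fun m =>
    (Dm m).moduleFinite_coeffRing
  letI : Algebra ℤ_[p] (unrIntegers p) := (toUnr p).toAlgebra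
  have hj : algebraMap ℤ_[p] (unrIntegers p) = toUnr p := rfl
  haveI : ∀ m : ℕ, Module.FaithfullyFlat (UnrSeries p)
      (PowerSeries (unrIntegers p ⊗[ℤ_[p]] padicCoeffIntegers (Dm m).ι)) := fun m =>
    faithfullyFlat_receptacle p (padicCoeffIntegers (Dm m).ι)
  -- the receptacle clause of every member: (2.5)_m under the torsion premise, and (c)
  have hrec : ∀ m : ℕ, ∃ Lm : PowerSeries (unrIntegers p ⊗[ℤ_[p]] padicCoeffIntegers (Dm m).ι),
      (Module.IsTorsion (PowerSeries (padicCoeffIntegers (Dm m).ι))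
          (XBig κ ((Dm m).Δ.cofreeRepOver K) 𝔭bar (↑(W.sigmaPlacesFinset p K) : Set (HeightOneSpectrum (𝓞 K)))) →
        (XBig.charIdeal κ ((Dm m).Δ.cofreeRepOver K) 𝔭bar
            (↑(W.sigmaPlacesFinset p K) : Set (HeightOneSpectrum (𝓞 K)))).map
            (PowerSeries.map (Algebra.TensorProduct.includeRight (R := ℤ_[p]) (A := unrIntegers p)
              (B := padicCoeffIntegers (Dm m).ι)).toRingHom) ≤ Ideal.span {Lm}) ∧
        Ideal.span {Lm} ≤
          Ideal.span {PowerSeries.map (algebraMap (unrIntegers p)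
              (unrIntegers p ⊗[ℤ_[p]] padicCoeffIntegers (Dm m).ι))
              (L * PowerSeries.map (toUnr p) (W.sigmaEulerElement p K κ))} ⊔
            Ideal.span {((p : ℕ) : PowerSeries (unrIntegers p ⊗[ℤ_[p]] padicCoeffIntegers (Dm m).ι)) ^
              (max m 1)} :=
    fun m => hDm m _ (algebraMap _ _) _ (toUnr p) (coe_toUnr p)
      (algebraMap_comp_toUnr_eq p (padicCoeffIntegers (Dm m).ι) hj)
  choose Lm hLm using hrec
  -- finite generation of `X^Σ_ac(A_{g_m})` over `Λ_{𝒪_m}`: [SU14] Lemma 3.1.9 (discharged `ℤ_p` fact) through (T6)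
  -- with (T7) `A_g` `p`-primary with finite `p`-torsion and (T8a) unramified outside `Σ ∪ S_p`
  haveI : ∀ m : ℕ, Module.Finite (PowerSeries (padicCoeffIntegers (Dm m).ι))
      (XBig κ ((Dm m).Δ.cofreeRepOver K) 𝔭bar (↑(W.sigmaPlacesFinset p K) : Set (HeightOneSpectrum (𝓞 K)))) :=
    fun m =>
      haveI := (Dm m).finiteDimensional_padicCoeffField
      SkinnerUrban2014.moduleFinite_XBig_of_lemma319 SkinnerUrban2014.lemma319_finite_XBig_holds κ 𝔭bar _ hSfin
        ((Dm m).Δ.cofreeRepOver K)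
        (GreenbergSelmer.Cofree.exists_pow_psmul_eq_zero (Dm m).ι (Dm m).Δ.ρ)
        (GreenbergSelmer.Cofree.divisible (padicCoeffField (Dm m).ι) (Dm m).Δ.ρ (Fact.out : p.Prime).ne_zero)
        (GreenbergSelmer.Cofree.finite_setOf_psmul_eq_zero (Dm m).ι (Dm m).Δ.ρ)
        (GreenbergSelmer.OrdinaryNewformDatum.cofreeRepOver_localMap_inr_apply_eq_self (Dm m).Δ K _ hSM)
  -- ### the member congruences `e_m` at `3 ≤ p`: Shapiro + (SelBC)_holds + (Frob) + (b) + Lemma 2.1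
  have hEm : ∀ m : ℕ, 1 ≤ m →
      Nonempty ((((PowerSeries (padicCoeffIntegers (Dm m).ι)) ⊗[IwasawaAlgebra p]
            AcSelmer.XAc (W.baseChange K) p κ 𝔭bar (↑(W.sigmaPlacesFinset p K) : Set (HeightOneSpectrum (𝓞 K))) γ) ⧸
          (((Ideal.span {(C (p : ℤ_[p]) : IwasawaAlgebra p)}).map
              (algebraMap (IwasawaAlgebra p) (PowerSeries (padicCoeffIntegers (Dm m).ι)))) ^ m •
            (⊤ : Submodule (PowerSeries (padicCoeffIntegers (Dm m).ι))
              ((PowerSeries (padicCoeffIntegers (Dm m).ι)) ⊗[IwasawaAlgebra p]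
                AcSelmer.XAc (W.baseChange K) p κ 𝔭bar (↑(W.sigmaPlacesFinset p K) : Set (HeightOneSpectrum (𝓞 K))) γ))))
          ≃ₗ[PowerSeries (padicCoeffIntegers (Dm m).ι)]
        (XBig κ ((Dm m).Δ.cofreeRepOver K) 𝔭bar (↑(W.sigmaPlacesFinset p K) : Set (HeightOneSpectrum (𝓞 K))) ⧸
          (((Ideal.span {(C (p : ℤ_[p]) : IwasawaAlgebra p)}).map
              (algebraMap (IwasawaAlgebra p) (PowerSeries (padicCoeffIntegers (Dm m).ι)))) ^ m •
            (⊤ : Submodule (PowerSeries (padicCoeffIntegers (Dm m).ι))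
              (XBig κ ((Dm m).Δ.cofreeRepOver K) 𝔭bar (↑(W.sigmaPlacesFinset p K) : Set (HeightOneSpectrum (𝓞 K)))))))) := by
    intro m hm
    exact nonempty_quotPow_congr_of_eq _ (max_eq_left hm)
      (nonempty_memberCongruence_odd_of_facts hSh Skinner2016.selmerBig_extendScalars_equiv_baseChange_holds hp
        hirr hK hHp 𝔭bar h𝔭bar φ hiv _ hSfin hSp hS hSM κ hκ γ (Dm m) (le_max_right m 1)).some
  -- ### (c), one-sided, with `(p^m)` in the consumer's spelling
  have hc' : ∀ m : ℕ, 1 ≤ m →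
      Ideal.span {Lm m} ≤
        Ideal.span {algebraMap (UnrSeries p) (PowerSeries (unrIntegers p ⊗[ℤ_[p]] padicCoeffIntegers (Dm m).ι))
            (L * PowerSeries.map (toUnr p) (W.sigmaEulerElement p K κ))} ⊔
          (((Ideal.span {(C (p : ℤ_[p]) : IwasawaAlgebra p)}).map (PowerSeries.map (toUnr p))).map
            (algebraMap (UnrSeries p) (PowerSeries (unrIntegers p ⊗[ℤ_[p]] padicCoeffIntegers (Dm m).ι)))) ^ m :=
    fun m hm => span_le_sup_of_receptacle p (padicCoeffIntegers (Dm m).ι) hm _ (Lm m) (hLm m).2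
  -- ### feed the two-slot Fitting congruence frame
  exact P2.RoadFF.fittingCongruenceFrameTwoSlotAt_of_members_descent_le_printed hΩ hL
    (L * PowerSeries.map (toUnr p) (W.sigmaEulerElement p K κ)) (dvd_refl _) hSfin
    (fun m => PowerSeries (padicCoeffIntegers (Dm m).ι))
    (fun m => PowerSeries (unrIntegers p ⊗[ℤ_[p]] padicCoeffIntegers (Dm m).ι))
    (fun m => PowerSeries.map (Algebra.TensorProduct.includeRight (R := ℤ_[p]) (A := unrIntegers p)
      (B := padicCoeffIntegers (Dm m).ι)).toRingHom)
    (fun m => map_includeRight_comp_algebraMap p (padicCoeffIntegers (Dm m).ι) hj)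
    (fun m => XBig κ ((Dm m).Δ.cofreeRepOver K) 𝔭bar (↑(W.sigmaPlacesFinset p K) : Set (HeightOneSpectrum (𝓞 K))))
    Lm (fun m hm => (hEm m hm).some) (fun m _ hTm => (hLm m).1 hTm) hc'

/-! ### §2 Specialisation: the 3-multiplicative twin of crux `TwinSplitIMCAtThreeMult` (binders of the route, `p = 3`) -/

/-- **THE DESCENT AT THE 3-MULTIPLICATIVE TWIN.** Under the binders of crux 20694 / ♭B — `W′/ℚ` globally minimal with
`Mult W′ 3`, `ρ̄_{W′,3}` onto, conductor `N′`, `K` imaginary quadratic with `SatisfiesHeegnerHypothesis N′ K` (so `3`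
splits), anticyclotomic `κ`, generator `γ`, frame prime `𝔭`, X-slot `𝔭' ∋ 3`, `ι'` — plus the LOCAL binder (dec)
`W′(ℚ₃)[3] = 0` (automatic for non-split multiplicative reduction at `3`; for split reduction it says the Tate
parameter of `W′/ℚ₃` is not a cube): a frame `(Ω_K, Ω_p, L)` of `f_{W′}` at `𝔭` and a Hida member tower of `f_{W′}`
at `p = 3` with the one-sided member inclusions (torsion-premise form) and (c) give the two-slot Fitting congruence
frame `P2.RoadFF.FittingCongruenceFrameTwoSlotAt W′ 3 κ 𝔭 𝔭' γ ι' f Σ(W′,3)(K) P_Σ`. (= §1 at `p = 3`; `Irr` from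
`Surj` by `hasIrreducibleModPGaloisRep_of_hasSurjectiveModNGaloisRep`; `SplitsIn K 3` from the Heegner hypothesis at
`3 ∣ N′`.) CONDITIONAL on Shapiro `hSh` (PUBLISHED) and the member tower (RESEARCH); nothing booked.
[cite: Skinner2016PacificMC, §2.6 (2-6-1), §3.1 (p. 192)] [cite: Castella2018Erratum, proof of Thm. 1.1 (p. 4) (shape)]
[cite: SkinnerUrban2014, Prop. 3.2.3] -/
theorem twin_fittingCongruenceFrameTwoSlotAt_of_memberTower
    (hSh : SkinnerUrban2014.prop323_XAc_equiv_XBigDecomp)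
    (W' : WeierstrassCurve ℚ) [W'.IsElliptic] [W'.IsGloballyMinimal] (N' : ℕ)
    (K : Type) [Field K] [NumberField K]
    (hm : Mult W' 3) (hsurj : W'.HasSurjectiveModNGaloisRep 3) (hN : W'.conductorNorm ℤ = N')
    (hK : IsImaginaryQuadratic K) (hH : SatisfiesHeegnerHypothesis N' K)
    (κ : ZpExtension K 3) (hκ : κ.IsAnticyclotomic) (γ : Field.absoluteGaloisGroup K) [Fact (κ.IsTopGenerator γ)]
    (𝔭 𝔭' : HeightOneSpectrum (𝓞 K)) (h𝔭' : ((3 : ℕ) : 𝓞 K) ∈ 𝔭'.asIdeal) (ι' : PadicAlgCl 3 ≃+* ℂ)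
    {M : ℕ} (f : CuspForm (CongruenceSubgroup.Gamma0 M) 2)
    (hiv : ∀ Q : (W'.baseChange ℚ_[3]).toAffine.Point, 3 • Q = 0 → Q = 0)
    {ΩK : ℂ} {Ωp : (unrIntegers 3)ˣ} {L : UnrSeries 3} (hΩ : ΩK ≠ 0)
    (hL : IsBDPLFunction ι' 𝔭 κ γ f ΩK ((Ωp : unrIntegers 3) : ℂ_[3]) L)
    (hmem : ∀ m : ℕ, 1 ≤ m →
      ∃ D : Skinner2016.HidaCongruentMember W' 3 m,
        ∀ [TopologicalSpace (PowerSeries (padicCoeffIntegers D.ι))]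
          [ContinuousSMul (PowerSeries (padicCoeffIntegers D.ι))
            (BigRepModule (padicCoeffIntegers D.ι) 3 (Cofree D.Δ.ρ (padicCoeffField D.ι)))],
        ∀ (S₀ : Type) [CommRing S₀] (a : unrIntegers 3 →+* S₀) (b : padicCoeffIntegers D.ι →+* S₀)
          (j : ℤ_[3] →+* unrIntegers 3),
          (∀ x : ℤ_[3], ((j x : unrIntegers 3) : ℂ_[3]) = algebraMap ℚ_[3] ℂ_[3] (x : ℚ_[3])) →
          a.comp j = b.comp (algebraMap ℤ_[3] (padicCoeffIntegers D.ι)) →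
          ∃ Lm : PowerSeries S₀,
            (Module.IsTorsion (PowerSeries (padicCoeffIntegers D.ι))
                (XBig κ (D.Δ.cofreeRepOver K) 𝔭' (↑(W'.sigmaPlacesFinset 3 K))) →
              (XBig.charIdeal κ (D.Δ.cofreeRepOver K) 𝔭' (↑(W'.sigmaPlacesFinset 3 K))).map
                  (PowerSeries.map b) ≤ Ideal.span {Lm}) ∧
            Ideal.span {Lm} ≤
              Ideal.span {PowerSeries.map a (L * PowerSeries.map j (W'.sigmaEulerElement 3 K κ))} ⊔
                Ideal.span {((3 : ℕ) : PowerSeries S₀) ^ m}) :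
    P2.RoadFF.FittingCongruenceFrameTwoSlotAt W' 3 κ 𝔭 𝔭' γ ι' f
      (↑(W'.sigmaPlacesFinset 3 K) : Set (HeightOneSpectrum (𝓞 K))) (W'.sigmaEulerElement 3 K κ) := by
  have hirr : Irr W' 3 := hasIrreducibleModPGaloisRep_of_hasSurjectiveModNGaloisRep W' 3 hsurj
  have hsp : SplitsIn K 3 := hH 3 Nat.prime_three (hN ▸ dvd_conductorNorm_of_mult hm)
  exact P2.RoadFF.fittingCongruenceFrameTwoSlotAt_of_memberTower_odd hSh W' 3 le_rfl K hK hirr hm hsp hiv κ hκ γ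
    𝔭 𝔭' h𝔭' ι' f hΩ hL hmem

/-! ### §3 With the twin's `Σ`-data: the rational Wan frame at the datum (consequent of `stub_wanFrameMult` / ♭B) -/

/-- **MEMBER TOWER + `Σ`-DATA ⟹ THE RATIONAL WAN FRAME OF THE 3-MULTIPLICATIVE TWIN AT THE DATUM (with `k = 0`).**
Same binders as `twin_fittingCongruenceFrameTwoSlotAt_of_memberTower`, plus the twin's `Σ`-data at the X-slot
(`P2.RoadFF.SigmaDataAt W′ 3 κ 𝔭' γ Σ P_Σ`: `Σ` finite, `X^Σ_ac(W′)` torsion, `P_Σ ≠ 0`, `Ch(X^∅)·(P_Σ) ⊆ Ch(X^Σ)`):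
there is a frame `(Ω_K ≠ 0, Ω_p ≠ 0, L)` of `f` at `𝔭` with
`∃ k, ∀ G ∈ Ch_Λ(X_ac(W′; slot 𝔭'))·R₀⟦T⟧, 3^k·G ∈ (L)` — VERBATIM the consequent of the registered stub
`stub_wanFrameMult` of line `threeframes` (and of act D's ♭B `TwinWanFrameAtThreeMult`) at this datum, witnessed with
`k = 0` by the tree's recombination `P2.exists_unrFrame_charIdeal_map_le_of_roadFF_fitting_twoSlot` (torsion bound,
`Σ`-removal, two-prime cancellation in the UFD `R₀⟦T⟧`). CONDITIONAL on Shapiro, the member tower (RESEARCH), the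
`Σ`-data and (dec); nothing booked; BSD is proved for no curve.
[cite: Castella2018Erratum, proof of Thm. 1.1 (p. 4), read one-sidedly] [cite: Skinner2016PacificMC, §3.1 (p. 192)]
[cite: SkinnerUrban2014, Prop. 3.2.3] -/
theorem twin_exists_wanFrame_of_sigmaData_of_memberTower
    (hSh : SkinnerUrban2014.prop323_XAc_equiv_XBigDecomp)
    (W' : WeierstrassCurve ℚ) [W'.IsElliptic] [W'.IsGloballyMinimal] (N' : ℕ)
    (K : Type) [Field K] [NumberField K]
    (hm : Mult W' 3) (hsurj : W'.HasSurjectiveModNGaloisRep 3) (hN : W'.conductorNorm ℤ = N')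
    (hK : IsImaginaryQuadratic K) (hH : SatisfiesHeegnerHypothesis N' K)
    (κ : ZpExtension K 3) (hκ : κ.IsAnticyclotomic) (γ : Field.absoluteGaloisGroup K) [Fact (κ.IsTopGenerator γ)]
    (𝔭 𝔭' : HeightOneSpectrum (𝓞 K)) (h𝔭' : ((3 : ℕ) : 𝓞 K) ∈ 𝔭'.asIdeal) (ι' : PadicAlgCl 3 ≃+* ℂ)
    {M : ℕ} (f : CuspForm (CongruenceSubgroup.Gamma0 M) 2)
    (hiv : ∀ Q : (W'.baseChange ℚ_[3]).toAffine.Point, 3 • Q = 0 → Q = 0)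
    (hSD : P2.RoadFF.SigmaDataAt W' 3 κ 𝔭' γ (↑(W'.sigmaPlacesFinset 3 K) : Set (HeightOneSpectrum (𝓞 K)))
      (W'.sigmaEulerElement 3 K κ))
    {ΩK : ℂ} {Ωp : (unrIntegers 3)ˣ} {L : UnrSeries 3} (hΩ : ΩK ≠ 0)
    (hL : IsBDPLFunction ι' 𝔭 κ γ f ΩK ((Ωp : unrIntegers 3) : ℂ_[3]) L)
    (hmem : ∀ m : ℕ, 1 ≤ m →
      ∃ D : Skinner2016.HidaCongruentMember W' 3 m,
        ∀ [TopologicalSpace (PowerSeries (padicCoeffIntegers D.ι))]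
          [ContinuousSMul (PowerSeries (padicCoeffIntegers D.ι))
            (BigRepModule (padicCoeffIntegers D.ι) 3 (Cofree D.Δ.ρ (padicCoeffField D.ι)))],
        ∀ (S₀ : Type) [CommRing S₀] (a : unrIntegers 3 →+* S₀) (b : padicCoeffIntegers D.ι →+* S₀)
          (j : ℤ_[3] →+* unrIntegers 3),
          (∀ x : ℤ_[3], ((j x : unrIntegers 3) : ℂ_[3]) = algebraMap ℚ_[3] ℂ_[3] (x : ℚ_[3])) →
          a.comp j = b.comp (algebraMap ℤ_[3] (padicCoeffIntegers D.ι)) →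
          ∃ Lm : PowerSeries S₀,
            (Module.IsTorsion (PowerSeries (padicCoeffIntegers D.ι))
                (XBig κ (D.Δ.cofreeRepOver K) 𝔭' (↑(W'.sigmaPlacesFinset 3 K))) →
              (XBig.charIdeal κ (D.Δ.cofreeRepOver K) 𝔭' (↑(W'.sigmaPlacesFinset 3 K))).map
                  (PowerSeries.map b) ≤ Ideal.span {Lm}) ∧
            Ideal.span {Lm} ≤
              Ideal.span {PowerSeries.map a (L * PowerSeries.map j (W'.sigmaEulerElement 3 K κ))} ⊔
                Ideal.span {((3 : ℕ) : PowerSeries S₀) ^ m}) :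
    ∃ (ΩK : ℂ) (Ωp : ℂ_[3]) (L : UnrSeries 3), ΩK ≠ 0 ∧ Ωp ≠ 0 ∧
      IsBDPLFunction ι' 𝔭 κ γ f ΩK Ωp L ∧
      ∃ k : ℕ, ∀ G ∈ (AcSelmer.XAc.charIdeal (W'.baseChange K) 3 κ 𝔭' ∅ γ).map
        (PowerSeries.map (toUnr 3)), PowerSeries.C (((3 : ℕ) : unrIntegers 3) ^ k) * G ∈ Ideal.span {L} := by
  obtain ⟨ΩK₁, Ωp₁, L₁, hΩ₁, hL₁, hdiv⟩ :=
    P2.exists_unrFrame_charIdeal_map_le_of_roadFF_fitting_twoSlot hSD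
      (twin_fittingCongruenceFrameTwoSlotAt_of_memberTower hSh W' N' K hm hsurj hN hK hH κ hκ γ 𝔭 𝔭' h𝔭' ι' f
        hiv hΩ hL hmem)
  refine ⟨ΩK₁, ((Ωp₁ : unrIntegers 3) : ℂ_[3]), L₁, hΩ₁, ?_, hL₁, 0, fun G hG => ?_⟩
  · have h1 : ‖((Ωp₁ : unrIntegers 3) : ℂ_[3])‖ = 1 := norm_coe_units_unrIntegers 3 Ωp₁
    intro h0
    rw [h0, norm_zero] at h1
    exact zero_ne_one h1
  · simpa using hdiv hG

end Summit.BirchSwinnertonDyer.Rank1Residual.X11b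

end
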